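import Mathlib
import Summits.Ventures.DiscreteObjects.Mahler.CensusResultantCuts
import Summits.Ventures.DiscreteObjects.Mahler.CensusSearchCutsVerdict

/-!
# Resultant power-sum cuts: table validation and census verdicts (venture `DiscreteObjects`, target L)

Cell `pub-namedobj`, seat `pub-namedobj-mahler-g14`. Framing: lottery ticket; floor = certified bounds/negative
ranges.

Companion of `CensusResultantCuts` (the arithmetic cuts `2d ≤ 2dλ₀ + Σ λ_k P_k + κ_m(B)²`, valid for IRREDUCIBLE
reciprocal `p` of degree `2d` with `M(p) < B`) in the format of the g13 kernel search `censusSearchC T CT`: a MIXED cut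
table `CT` (entry `k-1` = cuts `([λ_k,…,λ_1], N)` of depth `k`) is generated from tagged integer vectors `(v, none)`
(Toeplitz / Fejér–Riesz cut, `CensusSearchCuts.CutValid`) or `(v, some m)` (resultant cut with shift `m`, `CutValidR`) and
validated ONCE by the Boolean `cutTableCheckTR` (exact rational arithmetic, `decide`): `cutTableValidTR_of_check`.  Since
`DegreeCensus` quantifies over irreducible polynomials only, the search soundness and the verdicts go through verbatim:
`take_descCoeffList_mem_censusSearchC_of_irreducible`, `census_verdict_nonnegTR`, `degreeCensus_of_certified_nonnegTR`
(certificates for the survivors with `c₁ ≥ 0`, by the `x ↦ -x` symmetry).  The search function, the per-node unfolding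
(`mem_censusSearchC_node_iff`) and the certificate checker are those of mahler g12/g13, unchanged.
-/

namespace Summit.Ventures.DiscreteObjects.Mahler

open Polynomial

/-! ## Validating resultant cuts by computation (`B = Bn/Bd`) -/

/-- The resultant-cut constant `2d·λ₀(v) - 2d + κ_m(v; B)²` over `ℚ`, `B = Bn/Bd`. -/
def rcutConstQ (d Bn Bd : ℕ) (v : List ℤ) (m : ℕ) : ℚ :=
  2 * (d : ℚ) * ((lamZero v : ℤ) : ℚ) - 2 * (d : ℚ) +
    (∑ j ∈ Finset.range v.length, |((v.getD j 0 : ℤ) : ℚ)| *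
      (((Bn : ℚ) / Bd) ^ Nat.dist j m - ((((Bn : ℚ) / Bd) ^ Nat.dist j m))⁻¹)) ^ 2

/-- Boolean check of one resultant cut against its generating vector and shift. -/
def cutCheckR (d k Bn Bd : ℕ) (v : List ℤ) (m : ℕ) (c : List ℤ × ℤ) : Bool :=
  (v.length == k + 1) && decide (k + 1 ≤ 2 * d) && v.any (fun x => x != 0) && (c.1 == lamRevList v k) &&
    decide (rcutConstQ d Bn Bd v m < (c.2 : ℚ) + 1)

/-- Boolean check of one cut of a mixed table: tag `none` = Toeplitz cut, `some m` = resultant cut with shift `m`. -/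
def cutCheckTR (d k Bn Bd : ℕ) (g : List ℤ × Option ℕ) (c : List ℤ × ℤ) : Bool :=
  match g.2 with
  | none => cutCheck d k Bn Bd g.1 c
  | some m => cutCheckR d k Bn Bd g.1 m c

/-- Boolean check of the cuts of one depth against their tagged generating vectors (same order). -/
def cutsCheckTR (d k Bn Bd : ℕ) : List (List ℤ × Option ℕ) → List (List ℤ × ℤ) → Bool
  | [], [] => true
  | g :: gs, c :: cs => cutCheckTR d k Bn Bd g c && cutsCheckTR d k Bn Bd gs cs
  | _, _ => false

/-- Boolean check of a whole mixed table: `GT` lists the tagged generating vectors depth by depth. -/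
def cutTableCheckTR (d Bn Bd : ℕ) : ℕ → List (List (List ℤ × Option ℕ)) → List (List (List ℤ × ℤ)) → Bool
  | _, [], [] => true
  | k, gs :: GT, cs :: CT => cutsCheckTR d k Bn Bd gs cs && cutTableCheckTR d Bn Bd (k + 1) GT CT
  | _, _, _ => false

/-- A cut of a mixed table is valid if it is a valid Toeplitz cut or a valid resultant cut. -/
def CutValidTR (d k : ℕ) (B : ℝ) (c : List ℤ × ℤ) : Prop := CutValid d k B c ∨ CutValidR d k B c

/-- Every cut of the mixed table at every depth `1 ≤ k ≤ d` is valid. -/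
def CutTableValidTR (d : ℕ) (B : ℝ) (CT : List (List (List ℤ × ℤ))) : Prop :=
  ∀ k, 1 ≤ k → k ≤ d → ∀ c ∈ CT.getD (k - 1) [], CutValidTR d k B c

/-- Casting `κ` from the rational table constant. -/
theorem kappaR_map_cast (v : List ℤ) (m : ℕ) (B : ℚ) :
    kappaR (v.map (Int.cast : ℤ → ℝ)) m (B : ℝ) =
      ((∑ j ∈ Finset.range v.length, |((v.getD j 0 : ℤ) : ℚ)| * (B ^ Nat.dist j m - (B ^ Nat.dist j m)⁻¹) : ℚ) : ℝ) := by
  unfold kappaR sinhTerm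
  rw [List.length_map]
  push_cast
  apply Finset.sum_congr rfl
  intro j _
  rw [show ((v.map (Int.cast : ℤ → ℝ)).getD j 0) = ((v.getD j 0 : ℤ) : ℝ) by
    rw [show (0 : ℝ) = ((0 : ℤ) : ℝ) by simp, List.getD_map]]

/-- A checked resultant cut is valid (for `B = Bn/Bd`). -/
theorem cutValidR_of_check {d k Bn Bd : ℕ} {v : List ℤ} {m : ℕ} {c : List ℤ × ℤ}
    (h : cutCheckR d k Bn Bd v m c = true) : CutValidR d k ((Bn : ℝ) / Bd) c := by
  simp only [cutCheckR, Bool.and_eq_true, beq_iff_eq, decide_eq_true_eq, List.any_eq_true, bne_iff_ne, ne_eq] at h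
  obtain ⟨⟨⟨⟨hv, hk⟩, ⟨x, hxmem, hx0⟩⟩, hc1⟩, hlt⟩ := h
  obtain ⟨hlen, hget⟩ := lamRevList_spec v k
  have hnz : ∃ j, v.getD j 0 ≠ 0 := by
    obtain ⟨j, hj, rfl⟩ := List.getElem_of_mem hxmem
    exact ⟨j, by rwa [List.getD_eq_getElem _ _ hj]⟩
  refine ⟨by rw [hc1, hlen], v, m, hv, hk, hnz, fun j hj => by rw [hc1, hget j hj], ?_⟩
  have hcast : 2 * (d : ℝ) * ((lamZero v : ℤ) : ℝ) - 2 * (d : ℝ) + kappaR (v.map (Int.cast : ℤ → ℝ)) m ((Bn : ℝ) / Bd) ^ 2 =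
      ((rcutConstQ d Bn Bd v m : ℚ) : ℝ) := by
    rw [show ((Bn : ℝ) / Bd) = (((Bn : ℚ) / Bd : ℚ) : ℝ) by push_cast; rfl, kappaR_map_cast]
    unfold rcutConstQ; push_cast; rfl
  rw [hcast]
  exact_mod_cast hlt

/-- A checked cut of a mixed table is valid. -/
theorem cutValidTR_of_check {d k Bn Bd : ℕ} {g : List ℤ × Option ℕ} {c : List ℤ × ℤ}
    (h : cutCheckTR d k Bn Bd g c = true) : CutValidTR d k ((Bn : ℝ) / Bd) c := by
  unfold cutCheckTR at h
  obtain ⟨v, tag⟩ := g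
  cases tag with
  | none => exact Or.inl (cutValid_of_check h)
  | some m => exact Or.inr (cutValidR_of_check h)

/-- Checked cuts of one depth are valid. -/
theorem cutsValidTR_of_check {d k Bn Bd : ℕ} : ∀ (gs : List (List ℤ × Option ℕ)) (cs : List (List ℤ × ℤ)),
    cutsCheckTR d k Bn Bd gs cs = true → ∀ c ∈ cs, CutValidTR d k ((Bn : ℝ) / Bd) c := by
  intro gs
  induction gs with
  | nil => intro cs h c hc; cases cs with
    | nil => simp at hc
    | cons _ _ => simp [cutsCheckTR] at h
  | cons g gs ih =>
    intro cs h c hc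
    cases cs with
    | nil => simp at hc
    | cons c' cs =>
      simp only [cutsCheckTR, Bool.and_eq_true] at h
      rcases List.mem_cons.mp hc with rfl | hc
      · exact cutValidTR_of_check h.1
      · exact ih cs h.2 c hc

/-- **A checked mixed table is valid:** `cutTableCheckTR d Bn Bd 1 GT CT = true → CutTableValidTR d (Bn/Bd) CT`. -/
theorem cutTableValidTR_of_check {d Bn Bd : ℕ} {GT : List (List (List ℤ × Option ℕ))}
    {CT : List (List (List ℤ × ℤ))} (h : cutTableCheckTR d Bn Bd 1 GT CT = true) :
    CutTableValidTR d ((Bn : ℝ) / Bd) CT := by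
  suffices H : ∀ (GT : List (List (List ℤ × Option ℕ))) (CT : List (List (List ℤ × ℤ))) (k0 : ℕ),
      cutTableCheckTR d Bn Bd k0 GT CT = true →
        ∀ i < CT.length, ∀ c ∈ CT.getD i [], CutValidTR d (k0 + i) ((Bn : ℝ) / Bd) c by
    intro k hk1 _ c hc
    by_cases hi : k - 1 < CT.length
    · have := H GT CT 1 h (k - 1) hi c hc
      rwa [show 1 + (k - 1) = k by omega] at this
    · push Not at hi
      rw [List.getD_eq_default _ _ hi] at hc
      simp at hc
  intro GT
  induction GT with
  | nil =>
    intro CT k0 h i hi c hc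
    cases CT with
    | nil => simp at hi
    | cons _ _ => simp [cutTableCheckTR] at h
  | cons gs GT ih =>
    intro CT k0 h i hi c hc
    cases CT with
    | nil => simp at hi
    | cons cs CT =>
      simp only [cutTableCheckTR, Bool.and_eq_true] at h
      cases i with
      | zero =>
        rw [List.getD_cons_zero] at hc
        rw [Nat.add_zero]
        exact cutsValidTR_of_check gs cs h.1 c hc
      | succ i =>
        rw [List.getD_cons_succ] at hc
        have := ih CT (k0 + 1) h.2 i (by simpa using hi) c hc
        rwa [show k0 + 1 + i = k0 + (i + 1) by ring] at this

/-! ## Soundness of the search with a mixed table, for irreducible polynomials -/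

/-- The cuts of a valid mixed table hold for a monic IRREDUCIBLE palindromic `p` of degree `2d` with `M(p) < B`. -/
theorem cutTR_holds {p : ℤ[X]} {d : ℕ} (hmonic : p.Monic) (hirr : Irreducible p) (hdeg : p.natDegree = 2 * d)
    (hpal : ∀ j ≤ 2 * d, p.coeff j = p.coeff (2 * d - j)) {B : ℝ} (hB : intMahlerMeasure p < B) {k : ℕ}
    {c : List ℤ × ℤ} (hc : CutValidTR d k B c) :
    0 ≤ c.2 + (List.zipWith (· * ·) c.1 (psumsRev (descCoeffList p) k)).sum :=
  hc.elim (fun h => cut_holds hmonic hdeg hpal hB h) (fun h => rcut_holds hmonic hirr hdeg hpal hB h)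

/-- **Soundness of the search with a mixed table.** A monic irreducible palindromic `p ∈ ℤ[X]` of degree `2d ≥ 2` with
`M(p) < B` has its half coefficient vector in `censusSearchC T CT d [] []`, for valid thresholds (`|T| ≥ d`) and a valid
mixed cut table. -/
theorem take_descCoeffList_mem_censusSearchC_of_irreducible {p : ℤ[X]} {d : ℕ} (hd : 1 ≤ d) (hmonic : p.Monic)
    (hirr : Irreducible p) (hdeg : p.natDegree = 2 * d) (hpal : ∀ j ≤ 2 * d, p.coeff j = p.coeff (2 * d - j)) {B : ℝ}
    (hB : intMahlerMeasure p < B) {T : List ℕ} (hdT : d ≤ T.length) (hT : ThresholdsValid d B T)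
    {CT : List (List (List ℤ × ℤ))} (hCT : CutTableValidTR d B CT) :
    (descCoeffList p).take d ∈ censusSearchC T CT d [] [] := by
  apply mem_censusSearchC hdT _ (by rw [List.length_take, length_descCoeffList, hdeg]; omega)
  · intro k hk1 hk2
    rw [palC_take_descCoeffList hd hmonic hdeg hpal]
    have hP := rec_even_powerSum_test p d hd hmonic hdeg hpal hB (k := k) (by omega)
    rw [← rootPowerSum_def, rootPowerSum_eq_head hmonic hk1, Complex.norm_intCast] at hP
    have hTk := hT k hk1 hk2
    set N := (psumsRev (descCoeffList p) k).getD 0 0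
    have h1 : (|N| : ℝ) < (T.getD (k - 1) 0 : ℝ) + 1 := lt_of_lt_of_le hP hTk
    have h2 : |N| < (T.getD (k - 1) 0 : ℤ) + 1 := by exact_mod_cast h1
    have h3 : (N.natAbs : ℤ) ≤ (T.getD (k - 1) 0 : ℤ) := by rw [Int.natCast_natAbs]; omega
    exact_mod_cast h3
  · intro k hk1 hk2 c hc
    rw [palC_take_descCoeffList hd hmonic hdeg hpal]
    exact cutTR_holds hmonic hirr hdeg hpal hB (hCT k hk1 hk2 c hc)

/-! ## Verdicts (certificates for `c₁ ≥ 0` only) -/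

/-- **Census verdict from certificates for `c₁ ≥ 0` only (search with a mixed cut table).** -/
theorem census_verdict_nonnegTR {Bn Bd d : ℕ} {T : List ℕ} {CT : List (List (List ℤ × ℤ))} {L : List (List ℤ)}
    (hBd : 0 < Bd) (hd : 1 ≤ d) (hdT : d ≤ T.length) (hT : ThresholdsValid d ((Bn : ℝ) / Bd) T)
    (hCT : CutTableValidTR d ((Bn : ℝ) / Bd) CT)
    (hcert : ∀ a ∈ censusSearchC T CT d [] [], 0 ≤ a.getD 0 0 →
      ∃ c, checkCert Bn Bd (2 * d) L (1 :: palC a) c = true)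
    {p : ℤ[X]} (hmonic : p.Monic) (hdeg : p.natDegree = 2 * d)
    (hpal : ∀ j ≤ 2 * d, p.coeff j = p.coeff (2 * d - j)) (hirr : Irreducible p)
    (h1 : 1 < intMahlerMeasure p) (hB : intMahlerMeasure p < (Bn : ℝ) / Bd) :
    ∃ l ∈ L, p = ofCoeffs l ∨ p = (ofCoeffs l).comp (-X) := by
  have key : ∀ q : ℤ[X], q.Monic → q.natDegree = 2 * d → (∀ j ≤ 2 * d, q.coeff j = q.coeff (2 * d - j)) →
      Irreducible q → 1 < intMahlerMeasure q → intMahlerMeasure q < (Bn : ℝ) / Bd → 0 ≤ q.coeff (2 * d - 1) →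
      ∃ l ∈ L, q = ofCoeffs l ∨ q = (ofCoeffs l).comp (-X) := by
    intro q hqm hqd hqp hqi hq1 hqB hq0
    have hmem := take_descCoeffList_mem_censusSearchC_of_irreducible hd hqm hqi hqd hqp hqB hdT hT hCT
    obtain ⟨c, hc⟩ := hcert _ hmem (by rw [getD_zero_take_descCoeffList hd hqd]; exact hq0)
    rw [palC_take_descCoeffList hd hqm hqd hqp] at hc
    have hp := eq_ofCoeffs_descCoeffList hqm hqd hqp
    have hmon' : (ofCoeffs (1 :: descCoeffList q)).Monic := by rw [← hp]; exact hqm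
    have hdeg' : (ofCoeffs (1 :: descCoeffList q)).natDegree = 2 * d := by rw [← hp]; exact hqd
    have hs := checkCert_sound hBd hc hmon' hdeg'
    rw [← hp] at hs
    rcases hs with h | h | h | h
    · rw [h] at hq1; exact absurd hq1 (lt_irrefl _)
    · exact absurd hqi h
    · exact absurd hqB (not_lt.mpr h.le)
    · exact h
  by_cases h0 : 0 ≤ p.coeff (2 * d - 1)
  · exact key p hmonic hdeg hpal hirr h1 hB h0
  · push Not at h0
    obtain ⟨hqm, hqd, hqp, hqc⟩ := comp_neg_X_palindromic hd hmonic hdeg hpal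
    have hq := key (p.comp (-X)) hqm hqd hqp (irreducible_comp_neg_X hirr)
      (by rw [intMahlerMeasure_comp_neg_X]; exact h1) (by rw [intMahlerMeasure_comp_neg_X]; exact hB)
      (by rw [hqc]; omega)
    obtain ⟨l, hl, h⟩ := hq
    refine ⟨l, hl, ?_⟩
    rcases h with h | h
    · right; rw [← h, comp_neg_X_comp_neg_X]
    · left
      have := congrArg (fun r : ℤ[X] => r.comp (-X)) h
      simpa only [comp_neg_X_comp_neg_X] using this

/-- **From the halved kernel check (search with a mixed cut table) to a census row** (`B = Bn/Bd ≤ θ₀`). -/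
theorem degreeCensus_of_certified_nonnegTR {Bn Bd d : ℕ} {T : List ℕ} {CT : List (List (List ℤ × ℤ))}
    {L : List (List ℤ)} (hBd : 0 < Bd) (hd : 1 ≤ d) (hdT : d ≤ T.length) (hT : ThresholdsValid d ((Bn : ℝ) / Bd) T)
    (hCT : CutTableValidTR d ((Bn : ℝ) / Bd) CT) (hθ : (Bn : ℝ) / Bd ≤ smythTheta)
    (hcert : ∀ a ∈ censusSearchC T CT d [] [], 0 ≤ a.getD 0 0 →
      ∃ c, checkCert Bn Bd (2 * d) L (1 :: palC a) c = true) :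
    DegreeCensus (2 * d) ((Bn : ℝ) / Bd) L := by
  intro p hdeg hirr h1 h2
  have hrev := (reciprocal_of_measure_lt_smythTheta hirr h1 (lt_of_lt_of_le h2 hθ)).1
  have hlc : (|p.leadingCoeff| : ℝ) ≤ intMahlerMeasure p := abs_leadingCoeff_le_intMahlerMeasure p
  have hθ2 : smythTheta < 2 := by have := smythTheta_lt; linarith
  have hlc1 : p.leadingCoeff = 1 ∨ p.leadingCoeff = -1 := by
    have hne : p.leadingCoeff ≠ 0 := leadingCoeff_ne_zero.mpr hirr.ne_zero
    have hle : |p.leadingCoeff| ≤ 1 := by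
      by_contra h
      push Not at h
      have : (2 : ℝ) ≤ (|p.leadingCoeff| : ℝ) := by
        have : (2 : ℤ) ≤ |p.leadingCoeff| := h
        exact_mod_cast this
      linarith
    rcases abs_le.mp hle with ⟨h1', h2'⟩
    omega
  obtain ⟨hmonic, hpm, hMm, hdegm, hirrm⟩ := monic_normalisation hlc1
  set q := C p.leadingCoeff * p with hq
  have hrevq : q.reverse = q := by rw [hq, reverse_mul_of_domain, reverse_C, hrev]
  rw [hdeg] at hdegm
  have hpal := palindromic_of_reverse_eq_self q (2 * d) hdegm hrevq
  rw [← hMm] at h1 h2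
  obtain ⟨l, hl, hql⟩ := census_verdict_nonnegTR hBd hd hdT hT hCT hcert hmonic hdegm hpal (hirrm hirr) h1 h2
  refine ⟨l, hl, ?_⟩
  rcases hlc1 with hc | hc
  · have hpq : p = q := by rw [hpm, hc, C_1, one_mul]
    rcases hql with h | h
    · exact Or.inl (hpq.trans h)
    · exact Or.inr (Or.inr (Or.inl (hpq.trans h)))
  · have hpq : p = -q := by
      conv_lhs => rw [hpm, hc]
      simp
    rcases hql with h | h
    · exact Or.inr (Or.inl (by rw [hpq, h]))
    · exact Or.inr (Or.inr (Or.inr (by rw [hpq, h])))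

end Summit.Ventures.DiscreteObjects.Mahler
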